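import Literature.IUT.LogVolume.TensorPacketBaseExtensionRetraction
import Literature.IUT.LogVolume.UnitLogNormTrace
import HarnessLib

/-!
# Base extension of a tensor packet, III: SEMILINEAR trace transport ⇒ item (X) of the G1-Θ memo beyond
# saturation ([IUTchIV] Prop. 1.2; Thm. 1.10 Step (v))

abc-iut cell, prover seat abc-iut-f-167 (gen 5); sequel to abc-iut-w5-d036's `TensorPacketBaseExtension` /
`TensorPacketBaseExtensionRetraction` (item (X) along `φ = ⊗σ_i` under SATURATION of the log-shell lattice, resp.
from factorwise `ℚ_p`-linear RETRACTIONS `r_i ∘ σ_i = id` mapping `log_p(R'_i^×)` into `log_p(R_i^×)`) and to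
gen 4's `UnitLogNormTrace` (`Tr_{k'/k}(log_p(R'^×)) ⊆ log_p(R^×)` at every ramification; item (X) when
`p ∤ [k'_i : k_i]`). HERE the retraction hypothesis `r_i ∘ σ_i = id` is replaced by `k_i`-SEMILINEARITY
`r_i(σ_i(a)·y) = a·r_i(y)` — which the trace `Tr_{k'_i/k_i}` ALWAYS has — together with ONE integral element
`y_i ∈ R'_i` of controlled image `w_i := r_i(y_i)`; the slot-union upstairs being `(R'_I)^∼`-stable, `φ(u)·⊗y_i`
lies in it for every `u` in the slot-union downstairs, and the transport `ρ := ⊗_i r_i` satisfies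
`ρ(φ(u)·w) = u·ρ(w)`. PROVED:

* `map_mul_eq_mul_map_of_semilinear` — **`ρ(φ(u)·w) = u·ρ(w)`** (`ρ = ⊗r_i` is `V`-linear for the `V`-module
  structure of `V'` through `φ`; both sides are bilinear and agree on pure tensors);
* `mul_purePacket_mem_zpow_smul_logPacket_of_semilinear` — if the slot-union upstairs lies in `p^{m'}·log_p(R'_I^×)`
  then **`u·⊗_i w_i ∈ p^{m'}·log_p(R_I^×)`** for every `u` in the slot-union downstairs;
* `subset_zpow_smul_logPacket_of_semilinear` — hence, if `o·⊗w_i = p^T` for some `o ∈ (R_I)^∼` (e.g.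
  `‖w_i‖ ≥ p^{−T_i}`, `T = Σ T_i`, `exists_normalizedPacket_mul_purePacket_eq_ppow`), the slot-union downstairs lies in
  `p^{m'−T}·log_p(R_I^×)`: **content' ≤ content + T** with NO saturation hypothesis;
* `packetLogμ_packetHull_orbit_slotUnion_le_add_of_semilinear` — the orbit-hull volumes then satisfy
  `log μ̄(hull(⋃_γ γ·U)) + H' ≤ log μ̄'(hull'(⋃_{γ'} γ'·U')) + H + T·log p` (`H = log μ̄(hull(log_p(R_I^×)))`,
  `H' = log μ̄'(hull'(log_p(R'_I^×)))`, exact orbit formula of abc-iut-w5-d180);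
* **`packetLogμ_packetHull_orbit_slotUnion_le_of_semilinear_of_depth`** — item (X)
  `log μ̄(hull(⋃_γ γ·⋃_i ι_i(g_i)·(R_I)^∼)) ≤ log μ̄'(hull'(⋃_{γ'} γ'·⋃_i ι'_i(σ_i g_i)·(R'_I)^∼))` as soon as,
  factorwise, `log_p(R'_i^×)` reaches norm `≥ p^{T_i}·‖z‖` for every `z ∈ log_p(R_i^×)` (DEPTH hypothesis;
  `H' − H = Σ_i (log‖z'^max_i‖ − log‖z^max_i‖)`, abc-iut-w5-d082);
* **`packetLogμ_packetHull_orbit_slotUnion_le_of_trace_one`** (+ `'`, `_of_norm_eq`) — item (X) at EVERY prime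
  whenever every `k'_i/k_i` has an INTEGRAL ELEMENT OF TRACE ONE (`T_i = 0`: all tamely ramified relative
  extensions, any residue degree, any absolute ramification of the `k_i`); strictly contains gen 4's `p ∤ [k'_i:k_i]`;
* **`packetLogμ_packetHull_orbit_slotUnion_le_of_depth_finrank`** — item (X) at every prime for ARBITRARY
  `k'_i ⊇ σ_i(k_i)` modulo the depth hypothesis with `T_i = v_p([k'_i : k_i])` (`y_i = 1`, `Tr(1) = [k'_i:k_i]`).

HONEST SCOPE. The depth hypothesis is an explicit per-factor statement about the two log-unit lattices (at a wildly
ramified `k'_i/k_i` over a factor with `e(k_i)/(p−1)` not a power of `p` it follows from `(1 + ϖ'^{e_rel/p^t})^{p^t}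
= 1 + y`, `v(y) = 1/e(k_i)` — NOT proved here); the integral element of trace one (⟺ `k'_i/k_i` tamely ramified) is
likewise a hypothesis. Classical lattice algebra over the tree's typings of (Ind1)/(Ind2)/the hull of the disputed
corpus [claim: Mochizuki2012, status: disputed]; nothing here takes a side on [IUTchIII] Cor. 3.12; typed ≠ proved.
PROOF-ONLY file: no definitions, no named `Prop` facts. [cite: Mochizuki2012, IUTchIV Prop. 1.2 (ii) p. 10, Thm 1.10 proof Step (v) p. 27–28]
[cite: DupuyHilado2025, §4.7, §4.9, §4.12] [cite: NeukirchANT1999, Ch. II (4.8), (5.5)]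
-/

noncomputable section

open Set Module
open scoped Pointwise TensorProduct

namespace Literature.IUT.LogVolume

variable (p : ℕ) [Fact p.Prime]
variable {I : Type} [Fintype I] [DecidableEq I] [Nonempty I]
variable (k : I → Type) [∀ i, NontriviallyNormedField (k i)] [∀ i, NormedAlgebra ℚ_[p] (k i)]
  [∀ i, IsUltrametricDist (k i)] [∀ i, ProperSpace (k i)]
variable (k' : I → Type) [∀ i, NontriviallyNormedField (k' i)] [∀ i, NormedAlgebra ℚ_[p] (k' i)]
  [∀ i, IsUltrametricDist (k' i)] [∀ i, ProperSpace (k' i)]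
variable (φ : PacketAlgebra p k →ₐ[ℚ_[p]] PacketAlgebra p k')
variable (σ : ∀ i, k i →ₐ[ℚ_[p]] k' i) (hφ : ∀ (i : I) (a : k i), φ (iota p k i a) = iota p k' i (σ i a))
variable (r : ∀ i, k' i →ₗ[ℚ_[p]] k i) (hrlin : ∀ (i : I) (a : k i) (y : k' i), r i (σ i a * y) = a * r i y)

/-! ## §1 Semilinearity of the transport `ρ = ⊗_i r_i` -/

omit [Nonempty I] [∀ i, IsUltrametricDist (k i)] [∀ i, ProperSpace (k i)]
  [∀ i, IsUltrametricDist (k' i)] [∀ i, ProperSpace (k' i)] in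
include hφ hrlin in
/-- **`ρ(φ(u)·w) = u·ρ(w)`** for `ρ := ⊗_i r_i` with `k_i`-semilinear factors `r_i(σ_i(a)·y) = a·r_i(y)` and a packet
morphism `φ` with `φ(ι_i(a)) = ι'_i(σ_i a)`: both sides are `ℚ_p`-bilinear in `(u, w)` and agree on pure tensors
(`φ(⊗a_i)·⊗y_i = ⊗(σ_i(a_i) y_i) ↦ ⊗(a_i r_i(y_i)) = ⊗a_i·⊗r_i(y_i)`). [cite: NeukirchANT1999, Ch. II (4.8)]
[cite: Mochizuki2012, IUTchIV Prop. 1.1 p. 9] -/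
theorem map_mul_eq_mul_map_of_semilinear (u : PacketAlgebra p k) (w : PacketAlgebra p k') :
    PiTensorProduct.map r (φ u * w) = u * PiTensorProduct.map r w := by
  induction w using PiTensorProduct.induction_on with
  | smul_tprod c y =>
    induction u using PiTensorProduct.induction_on with
    | smul_tprod c' x =>
      have hxy : (fun i => r i (σ i (x i) * y i)) = fun i => x i * r i (y i) :=
        funext fun i => hrlin i (x i) (y i)
      change PiTensorProduct.map r (φ (c' • purePacket p k x) * (c • purePacket p k' y)) =
        (c' • purePacket p k x) * PiTensorProduct.map r (c • purePacket p k' y)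
      simp only [map_smul, smul_mul_assoc, mul_smul_comm, map_purePacket_of_iota p k k' φ σ hφ,
        purePacket_mul, map_purePacket_eq, Pi.mul_def, hxy]
    | add u₁ u₂ h₁ h₂ => rw [map_add, add_mul, map_add, h₁, h₂, add_mul]
  | add w₁ w₂ h₁ h₂ => rw [mul_add, map_add, h₁, h₂, map_add, mul_add]

/-! ## §2 Transport of `p`-power containers of the slot-union -/

include hφ hrlin in
/-- **`u·⊗_i r_i(y_i) ∈ p^{m'}·log_p(R_I^×)`** for every `u` in the slot-union `⋃_i ι_i(g_i)·(R_I)^∼`, whenever the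
slot-union of the images `⋃_i ι'_i(σ_i g_i)·(R'_I)^∼` lies in `p^{m'}·log_p(R'_I^×)`, the `r_i` are `k_i`-semilinear
and map log-units to log-units, and the `y_i ∈ R'_i` are integral: `φ(u)·⊗y_i` lies in the slot-union upstairs
(which is `(R'_I)^∼`-stable), `= p^{m'}·λ'`, and `ρ(p^{m'}·λ') = p^{m'}·ρ(λ') ∈ p^{m'}·log_p(R_I^×)` equals
`u·ρ(⊗y_i)`. [cite: Mochizuki2012, IUTchIV Prop. 1.2 (ii) p. 10] [cite: DupuyHilado2025, §4.7, §4.9] -/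
theorem mul_purePacket_mem_zpow_smul_logPacket_of_semilinear
    (hrΛ : ∀ (i : I) (z : k' i), z ∈ logUnits (k' i) → r i z ∈ logUnits (k i))
    {y : Π i, k' i} (hy : ∀ i, ‖y i‖ ≤ 1) (g : Π i, k i) {m' : ℤ}
    (hU' : (⋃ i, iota p k' i (σ i (g i)) • (normalizedPacket p k' : Set (PacketAlgebra p k'))) ⊆
      ((p : ℚ_[p]) ^ m') • (logPacket p k' : Set (PacketAlgebra p k')))
    {u : PacketAlgebra p k}
    (hu : u ∈ ⋃ i, iota p k i (g i) • (normalizedPacket p k : Set (PacketAlgebra p k))) :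
    u * purePacket p k (fun i => r i (y i)) ∈
      ((p : ℚ_[p]) ^ m') • (logPacket p k : Set (PacketAlgebra p k)) := by
  obtain ⟨i, hui⟩ := Set.mem_iUnion.mp hu
  obtain ⟨o, ho, rfl⟩ := Set.mem_smul_set.mp hui
  have hmem : φ (iota p k i (g i) • o) * purePacket p k' y ∈
      ⋃ i, iota p k' i (σ i (g i)) • (normalizedPacket p k' : Set (PacketAlgebra p k')) := by
    refine Set.mem_iUnion.mpr ⟨i, Set.mem_smul_set.mpr ⟨φ o * purePacket p k' y, ?_, ?_⟩⟩
    · exact Subring.mul_mem _ (map_mem_normalizedPacket p k k' φ ho)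
        (integerPacket_le_normalizedPacket p k' (purePacket_mem_integerPacket p k' hy))
    · rw [smul_eq_mul, smul_eq_mul, map_mul, hφ i, mul_assoc]
  obtain ⟨l', hl', hEq⟩ := Set.mem_smul_set.mp (hU' hmem)
  refine Set.mem_smul_set.mpr ⟨PiTensorProduct.map r l', image_logPacket_subset_of_retraction p k k' r hrΛ hl', ?_⟩
  have h := congrArg (PiTensorProduct.map r) hEq
  rw [map_smul, map_mul_eq_mul_map_of_semilinear p k k' φ σ hφ r hrlin, map_purePacket_eq] at h
  exact h

omit [DecidableEq I] [Nonempty I] [∀ i, IsUltrametricDist (k i)] [∀ i, ProperSpace (k i)] in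
/-- **A `p`-power multiple of `(⊗w_i)⁻¹` in `(R_I)^∼`**: if `‖w_i‖ ≥ p^{−T_i}` for every `i` then
`o := ⊗_i p^{T_i} w_i⁻¹ ∈ R_I ⊆ (R_I)^∼` and `o·⊗w_i = p^{Σ_i T_i}`. [cite: Mochizuki2012, IUTchIV Prop. 1.1 p. 9] -/
theorem exists_normalizedPacket_mul_purePacket_eq_ppow (w : Π i, k i) (T : I → ℕ)
    (hw : ∀ i, (p : ℝ) ^ (-(T i : ℤ)) ≤ ‖w i‖) :
    ∃ o ∈ normalizedPacket p k,
      o * purePacket p k w = algebraMap ℚ_[p] (PacketAlgebra p k) ((p : ℚ_[p]) ^ ∑ i, T i) := by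
  have hp : (0 : ℝ) < p := by exact_mod_cast (Fact.out : p.Prime).pos
  have hw0 : ∀ i, w i ≠ 0 := fun i => norm_pos_iff.mp (lt_of_lt_of_le (zpow_pos hp _) (hw i))
  refine ⟨purePacket p k (fun i => ((p : ℚ_[p]) ^ T i) • (w i)⁻¹),
    integerPacket_le_normalizedPacket p k (purePacket_mem_integerPacket p k fun i => ?_), ?_⟩
  · rw [norm_smul, norm_inv, Padic.norm_p_pow]
    calc (p : ℝ) ^ (-(T i : ℤ)) * ‖w i‖⁻¹ ≤ ‖w i‖ * ‖w i‖⁻¹ :=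
          mul_le_mul_of_nonneg_right (hw i) (inv_nonneg.mpr (norm_nonneg _))
      _ = 1 := mul_inv_cancel₀ (norm_ne_zero_iff.mpr (hw0 i))
  · rw [purePacket_mul]
    have h1 : ((fun i => ((p : ℚ_[p]) ^ T i) • (w i)⁻¹) * w) = fun i => ((p : ℚ_[p]) ^ T i) • (1 : Π i, k i) i :=
      funext fun i => by
        change (((p : ℚ_[p]) ^ T i) • (w i)⁻¹) * w i = ((p : ℚ_[p]) ^ T i) • 1
        rw [smul_mul_assoc, inv_mul_cancel₀ (hw0 i)]
    rw [h1, purePacket, MultilinearMap.map_smul_univ, Finset.prod_pow_eq_pow_sum, ← purePacket, purePacket_one,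
      Algebra.algebraMap_eq_smul_one]

include hφ hrlin in
/-- **Content' ≤ content + T, without saturation**: if the slot-union of the images lies in `p^{m'}·log_p(R'_I^×)`
and `o·⊗_i r_i(y_i) = p^T` for some `o ∈ (R_I)^∼` (integral `y_i`), then the slot-union `⋃_i ι_i(g_i)·(R_I)^∼`
lies in `p^{m'−T}·log_p(R_I^×)` (it is `(R_I)^∼`-stable, so `u·o` is again in it, and
`(u·o)·⊗r_i(y_i) = p^T·u ∈ p^{m'}·log_p(R_I^×)`). [cite: Mochizuki2012, IUTchIV Prop. 1.2 (ii) p. 10]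
[cite: DupuyHilado2025, §4.9] -/
theorem subset_zpow_smul_logPacket_of_semilinear
    (hrΛ : ∀ (i : I) (z : k' i), z ∈ logUnits (k' i) → r i z ∈ logUnits (k i))
    {y : Π i, k' i} (hy : ∀ i, ‖y i‖ ≤ 1) (g : Π i, k i) {m' : ℤ}
    (hU' : (⋃ i, iota p k' i (σ i (g i)) • (normalizedPacket p k' : Set (PacketAlgebra p k'))) ⊆
      ((p : ℚ_[p]) ^ m') • (logPacket p k' : Set (PacketAlgebra p k')))
    {T : ℕ} (hW : ∃ o ∈ normalizedPacket p k,
      o * purePacket p k (fun i => r i (y i)) = algebraMap ℚ_[p] (PacketAlgebra p k) ((p : ℚ_[p]) ^ T)) :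
    (⋃ i, iota p k i (g i) • (normalizedPacket p k : Set (PacketAlgebra p k))) ⊆
      ((p : ℚ_[p]) ^ (m' - T)) • (logPacket p k : Set (PacketAlgebra p k)) := by
  have hp0 : (p : ℚ_[p]) ≠ 0 := Nat.cast_ne_zero.mpr (Fact.out : p.Prime).ne_zero
  obtain ⟨o, ho, hoW⟩ := hW
  intro u hu
  obtain ⟨i, hui⟩ := Set.mem_iUnion.mp hu
  obtain ⟨o₁, ho₁, rfl⟩ := Set.mem_smul_set.mp hui
  have huo : iota p k i (g i) • o₁ * o ∈
      ⋃ i, iota p k i (g i) • (normalizedPacket p k : Set (PacketAlgebra p k)) :=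
    Set.mem_iUnion.mpr ⟨i, Set.mem_smul_set.mpr
      ⟨o₁ * o, Subring.mul_mem _ ho₁ ho, by rw [smul_eq_mul, smul_eq_mul, mul_assoc]⟩⟩
  have h := mul_purePacket_mem_zpow_smul_logPacket_of_semilinear p k k' φ σ hφ r hrlin hrΛ hy g hU' huo
  rw [mul_assoc, hoW, Algebra.algebraMap_eq_smul_one, mul_smul_comm, mul_one] at h
  obtain ⟨l, hl, hleq⟩ := Set.mem_smul_set.mp h
  refine Set.mem_smul_set.mpr ⟨l, hl, ?_⟩
  have hT : ((p : ℚ_[p]) ^ T) ≠ 0 := pow_ne_zero _ hp0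
  calc ((p : ℚ_[p]) ^ (m' - T)) • l = ((p : ℚ_[p]) ^ T)⁻¹ • (((p : ℚ_[p]) ^ m') • l) := by
        rw [smul_smul, zpow_sub₀ hp0, zpow_natCast, div_eq_inv_mul]
    _ = ((p : ℚ_[p]) ^ T)⁻¹ • (((p : ℚ_[p]) ^ T) • (iota p k i (g i) • o₁)) := by rw [hleq]
    _ = iota p k i (g i) • o₁ := by rw [smul_smul, inv_mul_cancel₀ hT, one_smul]

/-! ## §3 The orbit-hull volumes -/

include hφ hrlin in
/-- **Orbit-hull volumes along `φ` from semilinear transport**: for slot elements `g_i ∈ k_i^×`, `k_i`-semilinear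
`r_i` mapping log-units to log-units, integral `y_i` and `o ∈ (R_I)^∼` with `o·⊗r_i(y_i) = p^T`:
`log μ̄(hull(⋃_γ γ·U)) + H' ≤ log μ̄'(hull'(⋃_{γ'} γ'·U')) + H + T·log p` (`U`, `U'` the two slot-unions,
`H`, `H'` the hull-of-the-log-shell terms; both orbit volumes are `−(content)·log p + H`).
[cite: DupuyHilado2025, §4.9, §4.12] [cite: Mochizuki2012, IUTchIV Prop. 1.2 (ii) p. 10] -/
theorem packetLogμ_packetHull_orbit_slotUnion_le_add_of_semilinear
    (hrΛ : ∀ (i : I) (z : k' i), z ∈ logUnits (k' i) → r i z ∈ logUnits (k i))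
    {y : Π i, k' i} (hy : ∀ i, ‖y i‖ ≤ 1) {T : ℕ}
    (hW : ∃ o ∈ normalizedPacket p k,
      o * purePacket p k (fun i => r i (y i)) = algebraMap ℚ_[p] (PacketAlgebra p k) ((p : ℚ_[p]) ^ T))
    (g : Π i, k i) (hg : ∀ i, g i ≠ 0) :
    packetLogμ p k (packetHull p k
        (⋃ γ : indTwo p k, γ • ⋃ i, iota p k i (g i) • (normalizedPacket p k : Set (PacketAlgebra p k)))) +
        packetLogμ p k' (packetHull p k' (logPacket p k' : Set (PacketAlgebra p k'))) ≤
      packetLogμ p k' (packetHull p k'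
        (⋃ γ : indTwo p k', γ • ⋃ i, iota p k' i (σ i (g i)) •
          (normalizedPacket p k' : Set (PacketAlgebra p k')))) +
        packetLogμ p k (packetHull p k (logPacket p k : Set (PacketAlgebra p k))) + T * Real.log p := by
  obtain ⟨i₀⟩ := (inferInstance : Nonempty I)
  have hmem : ∀ (κ : I → Type) [∀ i, NontriviallyNormedField (κ i)] [∀ i, NormedAlgebra ℚ_[p] (κ i)]
      (h : Π i, κ i) (i : I), iota p κ i (h i) ∈
        ⋃ i, iota p κ i (h i) • (normalizedPacket p κ : Set (PacketAlgebra p κ)) := fun κ _ _ h i =>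
    Set.mem_iUnion.mpr ⟨i, Set.mem_smul_set.mpr ⟨1, Subring.one_mem _, by rw [smul_eq_mul, mul_one]⟩⟩
  have hg' : ∀ i, σ i (g i) ≠ 0 := fun i => (map_ne_zero (σ i)).mpr (hg i)
  obtain ⟨m, -, hm1, -, hvol⟩ := exists_packetLogμ_packetHull_orbit_eq p k
    (isPsiBounded_iUnion_iota_smul_normalizedPacket p k g)
    ⟨_, hmem k g i₀, (map_ne_zero (iota p k i₀)).mpr (hg i₀)⟩
  obtain ⟨m', hm', -, -, hvol'⟩ := exists_packetLogμ_packetHull_orbit_eq p k'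
    (isPsiBounded_iUnion_iota_smul_normalizedPacket p k' fun i => σ i (g i))
    ⟨_, hmem k' (fun i => σ i (g i)) i₀, (map_ne_zero (iota p k' i₀)).mpr (hg' i₀)⟩
  have hsub := subset_zpow_smul_logPacket_of_semilinear p k k' φ σ hφ r hrlin hrΛ hy g hm' hW
  have hle : m' - T ≤ m := by
    by_contra hlt
    exact hm1 (hsub.trans (zpow_smul_logPacket_anti p k (by omega)))
  have hlogp : 0 ≤ Real.log p := Real.log_nonneg (by exact_mod_cast (Fact.out : p.Prime).one_lt.le)
  have hle' : (m' : ℝ) - T ≤ m := by exact_mod_cast hle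
  rw [hvol, hvol']
  nlinarith

include hφ hrlin in
/-- **Item (X) from semilinear transport and factorwise DEPTH**: if moreover, for every factor `i` and every
`z ∈ log_p(R_i^×)`, some `z' ∈ log_p(R'_i^×)` has `‖z'‖ ≥ p^{T_i}·‖z‖` (the log-unit lattice upstairs is deeper
by `p^{T_i}`), where `o·⊗r_i(y_i) = p^{Σ_i T_i}`, then
`log μ̄(hull(⋃_γ γ·⋃_i ι_i(g_i)·(R_I)^∼)) ≤ log μ̄'(hull'(⋃_{γ'} γ'·⋃_i ι'_i(σ_i g_i)·(R'_I)^∼))`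
(`H' − H = Σ_i (log‖z'^max_i‖ − log‖z^max_i‖) ≥ (Σ_i T_i)·log p`).
[cite: Mochizuki2012, IUTchIV Thm 1.10 proof Step (v) p. 27–28, Prop. 1.2 (ii) p. 10] [cite: DupuyHilado2025, §4.7, §4.12] -/
theorem packetLogμ_packetHull_orbit_slotUnion_le_of_semilinear_of_depth
    (hrΛ : ∀ (i : I) (z : k' i), z ∈ logUnits (k' i) → r i z ∈ logUnits (k i))
    {y : Π i, k' i} (hy : ∀ i, ‖y i‖ ≤ 1) (T : I → ℕ)
    (hW : ∃ o ∈ normalizedPacket p k,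
      o * purePacket p k (fun i => r i (y i)) = algebraMap ℚ_[p] (PacketAlgebra p k) ((p : ℚ_[p]) ^ ∑ i, T i))
    (hdepth : ∀ i, ∀ z ∈ logUnits (k i), ∃ z' ∈ logUnits (k' i), (p : ℝ) ^ (T i) * ‖z‖ ≤ ‖z'‖)
    (g : Π i, k i) (hg : ∀ i, g i ≠ 0) :
    packetLogμ p k (packetHull p k
        (⋃ γ : indTwo p k, γ • ⋃ i, iota p k i (g i) • (normalizedPacket p k : Set (PacketAlgebra p k)))) ≤
      packetLogμ p k' (packetHull p k'
        (⋃ γ : indTwo p k', γ • ⋃ i, iota p k' i (σ i (g i)) •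
          (normalizedPacket p k' : Set (PacketAlgebra p k')))) := by
  have h1 := packetLogμ_packetHull_orbit_slotUnion_le_add_of_semilinear p k k' φ σ hφ r hrlin hrΛ hy hW g hg
  obtain ⟨z, hzmem, hz⟩ := exists_family_isMaxOn_logUnits p k
  obtain ⟨z', hzmem', hz'⟩ := exists_family_isMaxOn_logUnits p k'
  rw [packetLogμ_packetHull_logPacket_eq_sum p k hzmem hz,
    packetLogμ_packetHull_logPacket_eq_sum p k' hzmem' hz'] at h1
  have hp : (0 : ℝ) < p := by exact_mod_cast (Fact.out : p.Prime).pos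
  have h2 : ∀ i, Real.log ‖z i‖ + T i * Real.log p ≤ Real.log ‖z' i‖ := fun i => by
    obtain ⟨w, hw, hle⟩ := hdepth i (z i) (hzmem i)
    have hzpos : 0 < ‖z i‖ := norm_pos_of_isMaxOn_logUnits p (k i) (hz i)
    have hle' : (p : ℝ) ^ (T i) * ‖z i‖ ≤ ‖z' i‖ := hle.trans (hz' i w hw)
    have h := Real.log_le_log (mul_pos (pow_pos hp _) hzpos) hle'
    rw [Real.log_mul (pow_pos hp _).ne' hzpos.ne', Real.log_pow] at h
    linarith
  have h3 : ∑ i, Real.log ‖z i‖ + (∑ i, T i : ℕ) * Real.log p ≤ ∑ i, Real.log ‖z' i‖ := by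
    rw [Nat.cast_sum, Finset.sum_mul, ← Finset.sum_add_distrib]
    exact Finset.sum_le_sum fun i _ => h2 i
  linarith

/-! ## §4 The trace as the semilinear transport; item (X) from an integral element of trace one -/

section Trace

variable {p}
variable {K K' : Type} [NontriviallyNormedField K] [NormedAlgebra ℚ_[p] K] [IsUltrametricDist K] [ProperSpace K]
  [NontriviallyNormedField K'] [NormedAlgebra ℚ_[p] K'] [IsUltrametricDist K'] [ProperSpace K']

/-- **The trace `Tr_{k'/k}` is a `k`-semilinear `ℚ_p`-linear map `k' → k` carrying `log_p(R'^×)` into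
`log_p(R^×)`** (gen 4's `trace_mem_logUnits_of_algHom`), for the algebra structure given by an embedding
`σ : k → k'`. [cite: NeukirchANT1999, Ch. II (4.8), (5.5)] -/
theorem exists_semilinear_logUnits_trace (σ : K →ₐ[ℚ_[p]] K') :
    ∃ r : K' →ₗ[ℚ_[p]] K, (∀ (a : K) (y : K'), r (σ a * y) = a * r y) ∧
      (∀ z : K', z ∈ logUnits K' → r z ∈ logUnits K) ∧
      ∀ y : K', r y = (letI := σ.toRingHom.toAlgebra; Algebra.trace K K' y) := by
  letI : Algebra K K' := σ.toRingHom.toAlgebra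
  haveI : IsScalarTower ℚ_[p] K K' := IsScalarTower.of_algebraMap_eq fun x => (σ.commutes x).symm
  refine ⟨(Algebra.trace K K').restrictScalars ℚ_[p], fun a y => ?_,
    fun z hz => trace_mem_logUnits_of_algHom σ hz, fun y => rfl⟩
  have hσ : σ a * y = a • y := (Algebra.smul_def a y).symm
  rw [LinearMap.restrictScalars_apply, LinearMap.restrictScalars_apply, hσ, map_smul, smul_eq_mul]

omit [IsUltrametricDist K] [ProperSpace K] [IsUltrametricDist K'] [ProperSpace K'] in
/-- **`Tr_{k'/k}(1) = [k' : k]`.** [cite: NeukirchANT1999, Ch. II (4.8)] -/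
theorem trace_one_eq_finrank_of_algHom (σ : K →ₐ[ℚ_[p]] K') :
    letI := σ.toRingHom.toAlgebra
    Algebra.trace K K' 1 = (Module.finrank K K' : K) := by
  letI : Algebra K K' := σ.toRingHom.toAlgebra
  rw [← map_one (algebraMap K K'), Algebra.trace_algebraMap, nsmul_eq_mul, mul_one]

omit [IsUltrametricDist K] [ProperSpace K] in
/-- **`‖n‖ ≥ p^{−T}` with `T` the exponent of `p` in `n ≠ 0`** (`n = p^T·m`, `p ∤ m`, `‖m‖ = 1`).
[cite: NeukirchANT1999, Ch. II (4.8)] -/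
theorem zpow_neg_factorization_le_norm_natCast (n : ℕ) (hn : n ≠ 0) :
    (p : ℝ) ^ (-(n.factorization p : ℤ)) ≤ ‖(n : K)‖ := by
  have hpr : p.Prime := Fact.out
  have hsplit : (n : K) = ((p ^ n.factorization p : ℕ) : ℚ_[p]) • ((n / p ^ n.factorization p : ℕ) : K) := by
    rw [Nat.cast_smul_eq_nsmul, nsmul_eq_mul, ← Nat.cast_mul, Nat.ordProj_mul_ordCompl_eq_self]
  have hcop : p.Coprime (n / p ^ n.factorization p) := Nat.coprime_ordCompl hpr hn
  have h1 : ‖((n / p ^ n.factorization p : ℕ) : K)‖ = 1 := by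
    rw [← map_natCast (algebraMap ℚ_[p] K), norm_algebraMap', Padic.norm_natCast_eq_one_iff.mpr hcop]
  rw [hsplit, norm_smul, h1, mul_one, Nat.cast_pow, Padic.norm_p_pow]

end Trace

/-- **Item (X) at EVERY prime from an integral element of trace one on each factor**: for field embeddings
`σ_i : k_i → k'_i` such that every `k'_i` contains an integral `y_i` with `Tr_{k'_i/σ_i k_i}(y_i) = 1` (e.g. every
`k'_i/k_i` tamely ramified — `p` MAY divide the residue degree, and the `k_i` may be arbitrarily wildly ramified
over `ℚ_p`), a packet morphism `φ` with `φ(ι_i(a)) = ι'_i(σ_i a)`, and slot elements `g_i ∈ k_i^×`: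
`log μ̄(hull(⋃_γ γ·⋃_i ι_i(g_i)·(R_I)^∼)) ≤ log μ̄'(hull'(⋃_{γ'} γ'·⋃_i ι'_i(σ_i g_i)·(R'_I)^∼))` — content' ≤ content
by the semilinear trace transport, `H ≤ H'` by the isometries `σ_i`.
[cite: Mochizuki2012, IUTchIV Thm 1.10 proof Step (v) p. 27–28, Prop. 1.2 (ii) p. 10] [cite: DupuyHilado2025, §4.7, §4.9, §4.12]
[cite: NeukirchANT1999, Ch. II (4.8), (5.5)] -/
theorem packetLogμ_packetHull_orbit_slotUnion_le_of_trace_one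
    (σ : ∀ i, k i →ₐ[ℚ_[p]] k' i)
    (htr : ∀ i, ∃ y : k' i, ‖y‖ ≤ 1 ∧ (letI := (σ i).toRingHom.toAlgebra; Algebra.trace (k i) (k' i) y = 1))
    (φ : PacketAlgebra p k →ₐ[ℚ_[p]] PacketAlgebra p k')
    (hφ : ∀ (i : I) (a : k i), φ (iota p k i a) = iota p k' i (σ i a))
    (g : Π i, k i) (hg : ∀ i, g i ≠ 0) :
    packetLogμ p k (packetHull p k
        (⋃ γ : indTwo p k, γ • ⋃ i, iota p k i (g i) • (normalizedPacket p k : Set (PacketAlgebra p k)))) ≤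
      packetLogμ p k' (packetHull p k'
        (⋃ γ : indTwo p k', γ • ⋃ i, iota p k' i (σ i (g i)) •
          (normalizedPacket p k' : Set (PacketAlgebra p k')))) := by
  choose r hrlin hrΛ hrtr using fun i => exists_semilinear_logUnits_trace (p := p) (σ i)
  choose y hy1 hytr using htr
  have hry : (fun i => r i (y i)) = 1 := funext fun i => by rw [hrtr i, hytr i]; rfl
  have hW : ∃ o ∈ normalizedPacket p k, o * purePacket p k (fun i => r i (y i)) =
      algebraMap ℚ_[p] (PacketAlgebra p k) ((p : ℚ_[p]) ^ ∑ i, (fun _ : I => (0 : ℕ)) i) :=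
    ⟨1, Subring.one_mem _, by
      rw [hry, purePacket_one, one_mul, Finset.sum_const_zero, pow_zero, map_one]⟩
  refine packetLogμ_packetHull_orbit_slotUnion_le_of_semilinear_of_depth p k k' φ σ hφ r hrlin hrΛ hy1
    (fun _ => 0) hW (fun i z hz => ⟨σ i z, ?_, ?_⟩) g hg
  · exact image_logUnits_subset p (σ i).toRingHom (norm_map_algHom (σ i)) ⟨z, hz, rfl⟩
  · rw [pow_zero, one_mul, norm_map_algHom]

/-- **Item (X) from trace one, `σ`-only form** (`φ = ⊗σ_i` supplied by `exists_packetAlgHom_of_algHom`).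
[cite: Mochizuki2012, IUTchIV Thm 1.10 proof Step (v) p. 27–28] -/
theorem packetLogμ_packetHull_orbit_slotUnion_le_of_trace_one'
    (σ : ∀ i, k i →ₐ[ℚ_[p]] k' i)
    (htr : ∀ i, ∃ y : k' i, ‖y‖ ≤ 1 ∧ (letI := (σ i).toRingHom.toAlgebra; Algebra.trace (k i) (k' i) y = 1))
    (g : Π i, k i) (hg : ∀ i, g i ≠ 0) :
    packetLogμ p k (packetHull p k
        (⋃ γ : indTwo p k, γ • ⋃ i, iota p k i (g i) • (normalizedPacket p k : Set (PacketAlgebra p k)))) ≤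
      packetLogμ p k' (packetHull p k'
        (⋃ γ : indTwo p k', γ • ⋃ i, iota p k' i (σ i (g i)) •
          (normalizedPacket p k' : Set (PacketAlgebra p k')))) := by
  obtain ⟨φ, hφ⟩ := exists_packetAlgHom_of_algHom p k k' σ
  exact packetLogμ_packetHull_orbit_slotUnion_le_of_trace_one p k k' σ htr φ hφ g hg

/-- **Item (X) from trace one, norm-matched form** (big-field slots `g'_i` with `‖g'_i‖ = ‖g_i‖`, the shape the
G1-Θ assembly consumes). [cite: Mochizuki2012, IUTchIV Thm 1.10 proof Step (v) p. 27–28] -/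
theorem packetLogμ_packetHull_orbit_slotUnion_le_of_trace_one_of_norm_eq
    (σ : ∀ i, k i →ₐ[ℚ_[p]] k' i)
    (htr : ∀ i, ∃ y : k' i, ‖y‖ ≤ 1 ∧ (letI := (σ i).toRingHom.toAlgebra; Algebra.trace (k i) (k' i) y = 1))
    (g : Π i, k i) (hg : ∀ i, g i ≠ 0) (g' : Π i, k' i) (hgg' : ∀ i, ‖g' i‖ = ‖g i‖) :
    packetLogμ p k (packetHull p k
        (⋃ γ : indTwo p k, γ • ⋃ i, iota p k i (g i) • (normalizedPacket p k : Set (PacketAlgebra p k)))) ≤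
      packetLogμ p k' (packetHull p k'
        (⋃ γ : indTwo p k', γ • ⋃ i, iota p k' i (g' i) • (normalizedPacket p k' : Set (PacketAlgebra p k')))) := by
  have hσg : ∀ i, σ i (g i) ≠ 0 := fun i => (map_ne_zero (σ i)).mpr (hg i)
  have hn' : ∀ i, ‖g' i‖ = ‖σ i (g i)‖ := fun i => by rw [hgg' i, norm_map_algHom (σ i) (g i)]
  rw [iUnion_iota_smul_normalizedPacket_eq_of_norm_eq p k' (fun i => σ i (g i)) g' hσg hn']
  exact packetLogμ_packetHull_orbit_slotUnion_le_of_trace_one' p k k' σ htr g hg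

/-! ## §5 Arbitrary extensions: item (X) modulo depth `p^{v_p([k'_i : k_i])}` -/

/-- **Item (X) at every prime for ARBITRARY `k'_i ⊇ σ_i(k_i)`, modulo factorwise depth**: with `T_i` the exponent
of `p` in `[k'_i : σ_i k_i]` (so `y_i = 1`, `Tr(1) = [k'_i : k_i]`, `‖[k'_i:k_i]‖ ≥ p^{−T_i}`): if for every `i`
and every `z ∈ log_p(R_i^×)` some `z' ∈ log_p(R'_i^×)` has `‖z'‖ ≥ p^{T_i}·‖z‖`, then
`log μ̄(hull(⋃_γ γ·⋃_i ι_i(g_i)·(R_I)^∼)) ≤ log μ̄'(hull'(⋃_{γ'} γ'·⋃_i ι'_i(σ_i g_i)·(R'_I)^∼))`. At `p ∤ [k'_i:k_i]`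
(`T_i = 0`) the depth hypothesis is met by `z' = σ_i z` and this is gen 4's theorem.
[cite: Mochizuki2012, IUTchIV Thm 1.10 proof Step (v) p. 27–28, Prop. 1.2 (i)(ii) p. 10] [cite: DupuyHilado2025, §4.7, §4.9, §4.12]
[cite: NeukirchANT1999, Ch. II (4.8), (5.5)] -/
theorem packetLogμ_packetHull_orbit_slotUnion_le_of_depth_finrank
    (σ : ∀ i, k i →ₐ[ℚ_[p]] k' i)
    (hdepth : ∀ i, ∀ z ∈ logUnits (k i), ∃ z' ∈ logUnits (k' i),
      (p : ℝ) ^ ((letI := (σ i).toRingHom.toAlgebra; Module.finrank (k i) (k' i)).factorization p) * ‖z‖ ≤ ‖z'‖)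
    (φ : PacketAlgebra p k →ₐ[ℚ_[p]] PacketAlgebra p k')
    (hφ : ∀ (i : I) (a : k i), φ (iota p k i a) = iota p k' i (σ i a))
    (g : Π i, k i) (hg : ∀ i, g i ≠ 0) :
    packetLogμ p k (packetHull p k
        (⋃ γ : indTwo p k, γ • ⋃ i, iota p k i (g i) • (normalizedPacket p k : Set (PacketAlgebra p k)))) ≤
      packetLogμ p k' (packetHull p k'
        (⋃ γ : indTwo p k', γ • ⋃ i, iota p k' i (σ i (g i)) •
          (normalizedPacket p k' : Set (PacketAlgebra p k')))) := by
  choose r hrlin hrΛ hrtr using fun i => exists_semilinear_logUnits_trace (p := p) (σ i)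
  have hfin : ∀ i, (letI := (σ i).toRingHom.toAlgebra; Module.finrank (k i) (k' i)) ≠ 0 := fun i => by
    letI : Algebra (k i) (k' i) := (σ i).toRingHom.toAlgebra
    haveI : IsScalarTower ℚ_[p] (k i) (k' i) :=
      IsScalarTower.of_algebraMap_eq fun x => ((σ i).commutes x).symm
    haveI : FiniteDimensional ℚ_[p] (k' i) := FiniteDimensional.of_locallyCompactSpace ℚ_[p]
    haveI : FiniteDimensional (k i) (k' i) := Module.Finite.of_restrictScalars_finite ℚ_[p] (k i) (k' i)
    exact Module.finrank_pos.ne'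
  have hr1 : ∀ i, r i 1 = ((letI := (σ i).toRingHom.toAlgebra; Module.finrank (k i) (k' i) : ℕ) : k i) :=
    fun i => by rw [hrtr i, trace_one_eq_finrank_of_algHom (σ i)]
  obtain ⟨o, ho, hoW⟩ := exists_normalizedPacket_mul_purePacket_eq_ppow p k (fun i => r i 1)
    (fun i => (letI := (σ i).toRingHom.toAlgebra; Module.finrank (k i) (k' i)).factorization p)
    (fun i => by rw [hr1 i]; exact zpow_neg_factorization_le_norm_natCast _ (hfin i))
  exact packetLogμ_packetHull_orbit_slotUnion_le_of_semilinear_of_depth p k k' φ σ hφ r hrlin hrΛ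
    (y := fun _ => 1) (fun _ => by rw [norm_one]) _ ⟨o, ho, hoW⟩ hdepth g hg

end Literature.IUT.LogVolume

end
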